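import Literature.NumberTheory.Automorphic.UnitaryGroupHyperbolicTruncatedTraceClassUnfoldTwo
import Literature.NumberTheory.Automorphic.UnitaryGroupHyperbolicWeightedOrbitalUnfoldingTwo
import HarnessLib

/-!
# (`U(J₂)`, `H`-side copy) The truncated trace of the regular hyperbolic class, unfolded to `G(𝔸) ⧸ T(𝔸)`: Rogawski's (6.1.3) before `T → ∞`
(Rogawski, *Automorphic Representations of Unitary Groups in Three Variables* (1990), §6.1 pp. 79–80; §7.3 pp. 97–98, (6.1.1)–(6.1.3);
Arthur, *A trace formula for reductive groups I*, Duke Math. J. 45 (1978), §8.)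

Third step of the assembly of the hyperbolic term: ★ `truncatedTraceClass_borelRefine_hyperbolic_eq_mul_integral_sub_integral`
(STEP 2: `J^T_{i♯}(f) = c_μ·∫_{G(𝔸)} β·f(g⁻¹γ♯g)·u_T(g) dν_G − ∫_X R_T`) composed with the torus-fibre unfolding ★
`integral_weight_toReal_mul_conj_mul_uT_eq` / ★ `lintegral_weight_mul_enorm_conj_mul_indicator_eq` (★
`UnitaryGroupHyperbolicWeightedOrbitalUnfolding`: Weil along `T(𝔸)`, the rank-one window law in the fibre):

  `J^T_{i♯}(f) = c_μ · C · ∫_{G(𝔸) ⧸ T(𝔸)} f(x̃ γ♯ x̃⁻¹)·(2 log T − log H(x̃⁻¹) − log H(w x̃⁻¹)) d(ν_G/ρ)(x) − ∫_X R_T dμ`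

for `T ≥ 1`, under the finiteness `hint` (compact support of the orbit of `γ♯` modulo `T(𝔸)`) and the integrability of
the descended cusp remainder `R_T`. §1 supplies the two SPELLING BRIDGES between the `ite`-valued weight of the
`j`-kernel files and the indicator-valued weight of the torus-fibre file (pointwise; `‖·‖ₑ` of the weight is the
indicator of the truncated region, ★ `uT_eq_indicator_truncated`); §2 is the composition, the class-map letters being
discharged by ★ `UnitaryGroupHyperbolicBorelRefinedFibre` (`γ♯ ∈ T(𝔸)`, `Z_{G(F)}(γ♯) = G(F) ∩ T(𝔸)`).

Theorems only; no definitions, no instances, no notation.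
-/

open MeasureTheory Measure NumberField IsDedekindDomain Set Matrix Polynomial
open Literature.MeasureTheory.Group
open scoped NNReal ENNReal Classical MatrixGroups

namespace Literature.NumberTheory.Automorphic

namespace UnitaryGroup

variable {F E : Type} [Field F] [NumberField F] [Field E] [NumberField E] [Algebra F E]
  {c : E ≃ₐ[F] E}

/-! ## §1 Spelling bridges for Arthur's weight -/

section Bridges

/-- **`ite`-weight = indicator-weight**: `(1 − [T<H g] − [T<H(w♭g)] : ℂ) = ((1 − 1_{T<H}(g) − 1_{T<H}(w♭g) : ℝ) : ℂ)`.
[cite: Rogawski1990, §6.1 (pp. 79–80)] [cite: Arthur1978TraceFormulaI, §8] -/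
theorem jWeight_ite_eq_coe_indicator_two (wA : (quasiSplit F E c 2).Adelic) (T : ℝ≥0) (g : (quasiSplit F E c 2).Adelic) :
    ((1 : ℂ) - (if T < borelHeight g then (1 : ℂ) else 0) - (if T < borelHeight (wA * g) then (1 : ℂ) else 0)) =
      (((1 : ℝ) - {g : (quasiSplit F E c 2).Adelic | T < borelHeight g}.indicator 1 g -
          {g : (quasiSplit F E c 2).Adelic | T < borelHeight g}.indicator 1 (wA * g) : ℝ) : ℂ) := by
  simp only [Set.indicator_apply, Set.mem_setOf_eq, Pi.one_apply]
  split_ifs <;> push_cast <;> ring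

/-- **The `•`-integrand of the `j`-kernel unfolding is the `*`-integrand of the torus-fibre unfolding** (pointwise):
`(β g).toReal • (f(g⁻¹γg)·(1 − [T<H g] − [T<H(w♭g)])) = (β g).toReal · f(g⁻¹γg) · ((1 − 1_{T<H}(g) − 1_{T<H}(w♭g) : ℝ) : ℂ)`.
[cite: Rogawski1990, §6.1 (pp. 79–80)] [cite: Arthur1978TraceFormulaI, §8] -/
theorem smul_conj_mul_jWeight_eq_two (β : (quasiSplit F E c 2).Adelic → ℝ≥0∞) (f : (quasiSplit F E c 2).Adelic → ℂ)
    (γ wA : (quasiSplit F E c 2).Adelic) (T : ℝ≥0) (g : (quasiSplit F E c 2).Adelic) :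
    (β g).toReal • (f (g⁻¹ * γ * g) *
        ((1 : ℂ) - (if T < borelHeight g then (1 : ℂ) else 0) - (if T < borelHeight (wA * g) then (1 : ℂ) else 0))) =
      ((β g).toReal : ℂ) * f (g⁻¹ * γ * g) *
        (((1 : ℝ) - {g : (quasiSplit F E c 2).Adelic | T < borelHeight g}.indicator 1 g -
          {g : (quasiSplit F E c 2).Adelic | T < borelHeight g}.indicator 1 (wA * g) : ℝ) : ℂ) := by
  rw [jWeight_ite_eq_coe_indicator_two, Complex.real_smul]
  ring

/-- **`‖z · (1 − [T<H g] − [T<H(w g)])‖ₑ = ‖z‖ₑ · 1_{H ≤ T ∧ H∘w ≤ T}(g)`** for `T ≥ 1`: Arthur's weight is the indicator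
of the truncated region (★ `uT_eq_indicator_truncated_two`), of `‖·‖ₑ`-norm that indicator.
[cite: Rogawski1990, §6.1 (pp. 79–80)] [cite: Arthur1978TraceFormulaI, §8] -/
theorem enorm_mul_jWeight_eq_two {w : (quasiSplit F E c 2).Rational}
    (hw : ((w.1 : GL (Fin 2) E) : Matrix (Fin 2) (Fin 2) E) = !![(0 : E), 1; 1, 0])
    {T : ℝ≥0} (hT : 1 ≤ T) (z : ℂ) (g : (quasiSplit F E c 2).Adelic) :
    ‖z * ((1 : ℂ) - (if T < borelHeight g then (1 : ℂ) else 0) -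
        (if T < borelHeight ((quasiSplit F E c 2).toAdelic w * g) then (1 : ℂ) else 0))‖ₑ =
      ‖z‖ₑ * {g : (quasiSplit F E c 2).Adelic | borelHeight g ≤ T ∧
          borelHeight ((quasiSplit F E c 2).toAdelic w * g) ≤ T}.indicator 1 g := by
  rw [enorm_mul, jWeight_ite_eq_coe_indicator_two, uT_eq_indicator_truncated_two hw hT g]
  congr 1
  by_cases hg : g ∈ {g : (quasiSplit F E c 2).Adelic | borelHeight g ≤ T ∧
      borelHeight ((quasiSplit F E c 2).toAdelic w * g) ≤ T}
  · rw [Set.indicator_of_mem hg, Set.indicator_of_mem hg]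
    simp
  · rw [Set.indicator_of_notMem hg, Set.indicator_of_notMem hg]
    simp

end Bridges

/-! ## §2 `J^T_{i♯}(f) = c_μ · C · ∫_{G(𝔸) ⧸ T(𝔸)} f(x̃γ♯x̃⁻¹)(2 log T − log H(x̃⁻¹) − log H(wx̃⁻¹)) d(ν_G/ρ) − ∫_X R_T dμ` -/

section Torus

variable [MeasurableSpace (adelicUnipotent F E c 2)]
  [MeasurableSpace (quasiSplit F E c 2).Adelic] [BorelSpace (quasiSplit F E c 2).Adelic]
  [MeasurableSpace ((quasiSplit F E c 2).Adelic ⧸ torusAdelic F E c 2)]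
  [BorelSpace ((quasiSplit F E c 2).Adelic ⧸ torusAdelic F E c 2)]

/-- **ROGAWSKI'S (6.1.3) AT FINITE `T`** — the truncated trace of the refined regular hyperbolic class unfolded to
`G(𝔸) ⧸ T(𝔸)`: for an automorphic measure `μ`, a two-sided inversion-invariant Haar measure `ν_G` of `G(𝔸_F)`, an
inversion-invariant Haar measure `ρ` of `T(𝔸_F)`, `T ≥ 1`, a Borel `f` of compact support, a section of the fibre, a Borel
covering weight `β` of `Z_{G(F)}(γ♯)`, the rank-one window constant `Cw` of `ρ` (`hwin`, one constant for all
`T(F)`-covering weights — ★ `exists_rankOneInterval_forall_weight`), the finiteness `hint` of the unfolded weighted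
orbital majorant (compact support of the orbit of `γ♯` mod `T(𝔸)`) and the integrability `hR` of the descended cusp
remainder:
`J^T_{i♯}(f) = c_μ · Cw · ∫_{G(𝔸) ⧸ T(𝔸)} f(x̃ γ♯ x̃⁻¹)·(2 log T − log H(x̃⁻¹) − log H(w x̃⁻¹)) d(ν_G/ρ)(x) − ∫_X quotFun R_T dμ`.
[cite: Rogawski1990, §6.1 (6.1.1)–(6.1.3)] [cite: Arthur1978TraceFormulaI, §8] -/
theorem truncatedTraceClass_borelRefine_hyperbolic_eq_mul_mul_integral_quotient_sub_integral_two (hc : c * c = 1) {a : Eˣ}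
    (ha : c (a : E) * (a : E) ≠ 1) {g₀ w : (quasiSplit F E c 2).Rational}
    (hg₀ : ((g₀.1 : GL (Fin 2) E) : Matrix (Fin 2) (Fin 2) E) = !![(a : E), 0; 0, (c (a : E))⁻¹])
    (hw : ((w.1 : GL (Fin 2) E) : Matrix (Fin 2) (Fin 2) E) = !![(0 : E), 1; 1, 0])
    (μ : Measure (quasiSplit F E c 2).automorphicQuotient) [(quasiSplit F E c 2).IsAutomorphicMeasure μ]
    (νG : Measure (quasiSplit F E c 2).Adelic) [νG.IsHaarMeasure] [νG.IsMulRightInvariant] [νG.IsInvInvariant]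
    (ρ : Measure ↥(torusAdelic F E c 2)) [ρ.IsHaarMeasure] [ρ.IsInvInvariant]
    (ν : Measure (adelicUnipotent F E c 2)) (𝓕 : Set (adelicUnipotent F E c 2)) {T : ℝ≥0} (hT : 1 ≤ T)
    (sec : ((fun γ : (quasiSplit F E c 2).arithmeticSubgroup =>
        (((adelicVal F E c 2 _ (γ : (quasiSplit F E c 2).Adelic) : GL (Fin 2) (AdeleRing (𝓞 E) E)) :
            Matrix (Fin 2) (Fin 2) (AdeleRing (𝓞 E) E)).charpoly,
          decide (∃ δ : (quasiSplit F E c 2).arithmeticSubgroup, δ * γ * δ⁻¹ ∈ arithmeticBorel F E c 2))) ⁻¹'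
        {(((X - C (a : E)) * (X - C (c (a : E))⁻¹)).map (algebraMap E (AdeleRing (𝓞 E) E)), true)}) →
        (quasiSplit F E c 2).arithmeticSubgroup)
    (hsec : ∀ γ, (sec γ)⁻¹ * ⟨(quasiSplit F E c 2).toAdelic g₀, g₀, rfl⟩ * sec γ =
        (γ : (quasiSplit F E c 2).arithmeticSubgroup))
    {f : (quasiSplit F E c 2).Adelic → ℂ} (hf : HasCompactSupport f) (hfm : Measurable f)
    {β : (quasiSplit F E c 2).Adelic → ℝ≥0∞} (hβm : Measurable β)
    (hβ : IsCoveringWeight ((Subgroup.centralizer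
      {(⟨(quasiSplit F E c 2).toAdelic g₀, g₀, rfl⟩ : (quasiSplit F E c 2).arithmeticSubgroup)}).map
        (quasiSplit F E c 2).arithmeticSubgroup.subtype) β)
    {Cw : ℝ≥0∞} (hC : Cw ≠ ⊤)
    (hwin : ∀ β' : torusInBorel F E c 2 → ℝ≥0∞,
      IsCoveringWeight ((rationalBorel F E c 2).subgroupOf (torusInBorel F E c 2)) β' →
      ∀ A B : ℝ≥0, 0 < A → A ≤ B →
        ∫⁻ s : torusInBorel F E c 2, β' s * {s : torusInBorel F E c 2 |
            A < borelHeight (((s : torusInBorel F E c 2) : borelAdelic F E c 2) : (quasiSplit F E c 2).Adelic) ∧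
            borelHeight (((s : torusInBorel F E c 2) : borelAdelic F E c 2) : (quasiSplit F E c 2).Adelic) ≤ B}.indicator
            1 s ∂(Measure.map (⇑(Subgroup.subgroupOfEquivOfLe
              (torusAdelic_le_borelAdelic (F := F) (E := E) (c := c) (N := 2))).symm) ρ :
                Measure (torusInBorel F E c 2)) =
          Cw * ENNReal.ofReal (Real.log (B : ℝ) - Real.log (A : ℝ)))
    (hint : ∫⁻ x : (quasiSplit F E c 2).Adelic ⧸ torusAdelic F E c 2,
        ‖f ((x.out : (quasiSplit F E c 2).Adelic) * (quasiSplit F E c 2).toAdelic g₀ * (x.out : (quasiSplit F E c 2).Adelic)⁻¹)‖ₑ *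
          ENNReal.ofReal (2 * Real.log (T : ℝ) - Real.log (borelHeight (x.out : (quasiSplit F E c 2).Adelic)⁻¹ : ℝ) -
            Real.log (borelHeight ((quasiSplit F E c 2).toAdelic w * (x.out : (quasiSplit F E c 2).Adelic)⁻¹) : ℝ))
        ∂(haveI := t2Space_quasiSplitAdelic (F := F) (E := E) (c := c) (N := 2)
          haveI := locallyCompactSpace_quasiSplitAdelic (F := F) (E := E) (c := c) (N := 2)
          haveI := secondCountableTopology_quasiSplitAdelic (F := F) (E := E) (c := c) (N := 2)
          quotientMeasure (torusAdelic F E c 2) ρ isClosed_torusAdelic νG) < ⊤)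
    (hR : Integrable ((quasiSplit F E c 2).quotFun (pseudoEisenstein
      ({y : (quasiSplit F E c 2).Adelic | T < borelHeight y}.indicator fun y =>
        kernelBorelClass ν 𝓕
            (fun γ : (quasiSplit F E c 2).arithmeticSubgroup =>
              (((adelicVal F E c 2 _ (γ : (quasiSplit F E c 2).Adelic) : GL (Fin 2) (AdeleRing (𝓞 E) E)) :
                  Matrix (Fin 2) (Fin 2) (AdeleRing (𝓞 E) E)).charpoly,
                decide (∃ δ : (quasiSplit F E c 2).arithmeticSubgroup, δ * γ * δ⁻¹ ∈ arithmeticBorel F E c 2)))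
            (((X - C (a : E)) * (X - C (c (a : E))⁻¹)).map (algebraMap E (AdeleRing (𝓞 E) E)), true) f y y -
          borelSumClass
            (fun γ : (quasiSplit F E c 2).arithmeticSubgroup =>
              (((adelicVal F E c 2 _ (γ : (quasiSplit F E c 2).Adelic) : GL (Fin 2) (AdeleRing (𝓞 E) E)) :
                  Matrix (Fin 2) (Fin 2) (AdeleRing (𝓞 E) E)).charpoly,
                decide (∃ δ : (quasiSplit F E c 2).arithmeticSubgroup, δ * γ * δ⁻¹ ∈ arithmeticBorel F E c 2)))
            (((X - C (a : E)) * (X - C (c (a : E))⁻¹)).map (algebraMap E (AdeleRing (𝓞 E) E)), true) f y y))) μ) :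
    haveI := t2Space_adeleRing_of_numberField E
    haveI := locallyCompactSpace_adeleRing' E
    haveI := secondCountableTopology_adeleRing E
    haveI : T2Space (quasiSplit F E c 2).Adelic :=
      inferInstanceAs (T2Space (adelic F E c 2 ((StdForm.antidiagonal 2).over E)))
    haveI : LocallyCompactSpace (quasiSplit F E c 2).Adelic :=
      inferInstanceAs (LocallyCompactSpace (adelic F E c 2 ((StdForm.antidiagonal 2).over E)))
    haveI : SecondCountableTopology (quasiSplit F E c 2).Adelic :=
      inferInstanceAs (SecondCountableTopology (adelic F E c 2 ((StdForm.antidiagonal 2).over E)))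
    haveI : DiscreteTopology (quasiSplit F E c 2).quotientSubgroup := by
      rw [quotientSubgroup_quasiSplit]; exact isDiscreteRational_quasiSplit
    letI := AdelicGroupData.measurableSpaceQuotientForm (quasiSplit F E c 2)
    haveI := AdelicGroupData.borelSpaceQuotientForm (quasiSplit F E c 2)
    haveI := AdelicGroupData.smulInvariantMeasureQuotientForm (quasiSplit F E c 2) μ
    haveI := AdelicGroupData.isFiniteMeasureOnCompactsQuotientForm (quasiSplit F E c 2) μ
    truncatedTraceClass μ ν 𝓕 T
        (fun γ : (quasiSplit F E c 2).arithmeticSubgroup =>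
          (((adelicVal F E c 2 _ (γ : (quasiSplit F E c 2).Adelic) : GL (Fin 2) (AdeleRing (𝓞 E) E)) :
              Matrix (Fin 2) (Fin 2) (AdeleRing (𝓞 E) E)).charpoly,
            decide (∃ δ : (quasiSplit F E c 2).arithmeticSubgroup, δ * γ * δ⁻¹ ∈ arithmeticBorel F E c 2)))
        (((X - C (a : E)) * (X - C (c (a : E))⁻¹)).map (algebraMap E (AdeleRing (𝓞 E) E)), true) f =
      ((unfoldingConstant (quasiSplit F E c 2).quotientSubgroup
            (count : Measure (quasiSplit F E c 2).quotientSubgroup) μ νG : ℝ) : ℂ) *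
        ((Cw.toReal : ℂ) * ∫ x : (quasiSplit F E c 2).Adelic ⧸ torusAdelic F E c 2,
          f ((x.out : (quasiSplit F E c 2).Adelic) * (quasiSplit F E c 2).toAdelic g₀ * (x.out : (quasiSplit F E c 2).Adelic)⁻¹) *
            ((2 * Real.log (T : ℝ) - Real.log (borelHeight (x.out : (quasiSplit F E c 2).Adelic)⁻¹ : ℝ) -
              Real.log (borelHeight ((quasiSplit F E c 2).toAdelic w * (x.out : (quasiSplit F E c 2).Adelic)⁻¹) : ℝ) : ℝ) : ℂ)
          ∂(quotientMeasure (torusAdelic F E c 2) ρ isClosed_torusAdelic νG)) -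
      ∫ x, (quasiSplit F E c 2).quotFun (pseudoEisenstein
        ({y : (quasiSplit F E c 2).Adelic | T < borelHeight y}.indicator fun y =>
          kernelBorelClass ν 𝓕
              (fun γ : (quasiSplit F E c 2).arithmeticSubgroup =>
                (((adelicVal F E c 2 _ (γ : (quasiSplit F E c 2).Adelic) : GL (Fin 2) (AdeleRing (𝓞 E) E)) :
                    Matrix (Fin 2) (Fin 2) (AdeleRing (𝓞 E) E)).charpoly,
                  decide (∃ δ : (quasiSplit F E c 2).arithmeticSubgroup, δ * γ * δ⁻¹ ∈ arithmeticBorel F E c 2)))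
              (((X - C (a : E)) * (X - C (c (a : E))⁻¹)).map (algebraMap E (AdeleRing (𝓞 E) E)), true) f y y -
            borelSumClass
              (fun γ : (quasiSplit F E c 2).arithmeticSubgroup =>
                (((adelicVal F E c 2 _ (γ : (quasiSplit F E c 2).Adelic) : GL (Fin 2) (AdeleRing (𝓞 E) E)) :
                    Matrix (Fin 2) (Fin 2) (AdeleRing (𝓞 E) E)).charpoly,
                  decide (∃ δ : (quasiSplit F E c 2).arithmeticSubgroup, δ * γ * δ⁻¹ ∈ arithmeticBorel F E c 2)))
              (((X - C (a : E)) * (X - C (c (a : E))⁻¹)).map (algebraMap E (AdeleRing (𝓞 E) E)), true) f y y)) x ∂μ := by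
  haveI := t2Space_quasiSplitAdelic (F := F) (E := E) (c := c) (N := 2)
  haveI := locallyCompactSpace_quasiSplitAdelic (F := F) (E := E) (c := c) (N := 2)
  haveI := secondCountableTopology_quasiSplitAdelic (F := F) (E := E) (c := c) (N := 2)
  -- the letters of the torus-fibre file
  have hγ : (quasiSplit F E c 2).toAdelic g₀ ∈ torusAdelic F E c 2 :=
    coe_mk_toAdelic_mem_torusAdelic_of_eq_hyperbolicDiagonal_two hg₀
  have hβT := isCoveringWeight_torus_translate_two hβ
    (mem_centralizer_mk_toAdelic_hyperbolic_iff_mem_torusAdelic_two ha hg₀)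
  -- finiteness of the unfolded majorant of the `j`-kernel (FILE B's `hfin`) from `hint`
  have hfin : ∫⁻ g, β g * ‖f (g⁻¹ * (quasiSplit F E c 2).toAdelic g₀ * g) *
      ((1 : ℂ) - (if T < borelHeight g then (1 : ℂ) else 0) -
        (if T < borelHeight ((quasiSplit F E c 2).toAdelic w * g) then (1 : ℂ) else 0))‖ₑ ∂νG < ∞ := by
    have hrw : (fun g => β g * ‖f (g⁻¹ * (quasiSplit F E c 2).toAdelic g₀ * g) *
        ((1 : ℂ) - (if T < borelHeight g then (1 : ℂ) else 0) -
          (if T < borelHeight ((quasiSplit F E c 2).toAdelic w * g) then (1 : ℂ) else 0))‖ₑ) =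
        fun g => β g * ‖f (g⁻¹ * (quasiSplit F E c 2).toAdelic g₀ * g)‖ₑ *
          {g : (quasiSplit F E c 2).Adelic | borelHeight g ≤ T ∧
            borelHeight ((quasiSplit F E c 2).toAdelic w * g) ≤ T}.indicator 1 g := by
      funext g
      rw [enorm_mul_jWeight_eq_two hw hT, ← mul_assoc]
    rw [hrw, lintegral_weight_mul_enorm_conj_mul_indicator_eq_two hγ hw hT νG ρ hβm hβT hC hwin hfm]
    exact ENNReal.mul_lt_top hC.lt_top hint
  obtain ⟨-, hval⟩ := integral_weight_toReal_mul_conj_mul_uT_eq_two hγ hw hT νG ρ hβm hβT hC hwin hfm hint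
  rw [truncatedTraceClass_borelRefine_hyperbolic_eq_mul_integral_sub_integral_two hc ha hg₀ hw μ νG ν 𝓕
    (lt_of_lt_of_le zero_lt_one hT) sec hsec hf hfm hβ hfin hR]
  congr 2
  rw [← hval]
  refine integral_congr_ae (Filter.Eventually.of_forall fun g => ?_)
  exact smul_conj_mul_jWeight_eq_two β f _ _ T g

end Torus

end UnitaryGroup

end Literature.NumberTheory.Automorphic
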